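import Summits.CriticalPhenomena.CardyFormulaZ2.Theorems.CardyMagicRigidityNestingRigidityUVExpMomentsChargeFree
import Summits.CriticalPhenomena.CardyFormulaZ2.Theorems.CardyMagicRigidityNestingRigidityUVFarBite
import Summits.CriticalPhenomena.CardyFormulaZ2.Theorems.CardyMagicRigidityNestingRigidityUVFarBiteSq
import Summits.CriticalPhenomena.CardyFormulaZ2.Theorems.CardyMagicRigidityNestingRigidityUVCollar
import HarnessLib

/-!
# Crux `NestingRigidity`: helper [A] `uvExpMoments_latticeEnsembles` CLOSED (untilted all-order exponential moments of the
# centred additive UV statistic of the cone cloud and of `Θ₂`, both lattices)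

Crux `Summit.CriticalPhenomena.CardyFormulaZ2.Theses.CardyMagicRigidity.NestingRigidity` (stmt-CriticalPhenomena-4835), line
`positive-cone-weight-doubling`, registered helper [A] toward R1' (`stub_uvDecoupling`, landed p133026).  The registered statement verbatim,
as the composition of the landed reduction `uvExpMoments_of_chargeFree_bounds` (…UVExpMomentsChargeFree p129762) with its three charge-free
inputs Ξ `uvFarBite_expMoment_latticeEnsembles` (p132797), Ξ₂ `uvFarBiteSq_expMoment_latticeEnsembles` (p132341), K
`uvCollar_expMoment_latticeEnsembles` (p132406).  No cited fact, no definition.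
-/

noncomputable section

open MeasureTheory Filter Set Topology
open scoped Real ENNReal BigOperators
open Literature.Probability.RandomPlanarGeometry Literature.Probability.Percolation
  Literature.Probability.LatticeModels
open Summit.CriticalPhenomena.CardyFormulaZ2.Cruxes.NestingRigidity.RingCloudTomography

namespace Summit.CriticalPhenomena.CardyFormulaZ2.Cruxes.NestingRigidity.PositiveConeWeightDoubling

/-- **[A] closed · untilted exponential moments of all orders of the centred UV statistic `Θ + t·E_δ N` (both signs) and of `Θ₂`,
both lattices** (registered helper `uvExpMoments_latticeEnsembles`). -/
theorem uvExpMoments_latticeEnsembles : ∀ E ∈ latticeEnsembles,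
    ∀ t ∈ Set.Ioo (-(π / 6)) (π / 6), ∀ s : ℝ, 0 < s → ∃ C r₀ : ℝ, 0 < r₀ ∧ ∀ r ∈ Set.Ioo (0 : ℝ) r₀,
      ∀ᶠ δ in 𝓝[>] (0 : ℝ), ∀ Θ Θ₂ : E.Ω → ℝ,
        (∀ ω, Θ ω = ∑ᶠ u ∈ (E.X δ ω).loops \ {u ∈ (E.X δ ω).loops |
            Metric.closedBall (0 : ℂ) r ⊆ {z | u.wind z ≠ 0} ∧ u.range ⊆ Metric.ball (0 : ℂ) 1},
            u.nestingPhase (coneCloud t r).density) →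
        (∀ ω, Θ₂ ω = ∑ᶠ u ∈ (E.X δ ω).loops \ {u ∈ (E.X δ ω).loops |
            Metric.closedBall (0 : ℂ) r ⊆ {z | u.wind z ≠ 0} ∧ u.range ⊆ Metric.ball (0 : ℂ) 1},
            u.nestingPhase (coneCloud t r).density ^ 2) →
        Integrable (fun ω ↦ Real.exp (s * (Θ ω + t * meanTower E δ r))) E.P ∧
        ∫ ω, Real.exp (s * (Θ ω + t * meanTower E δ r)) ∂E.P ≤ C ∧
        Integrable (fun ω ↦ Real.exp (-(s * (Θ ω + t * meanTower E δ r)))) E.P ∧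
        ∫ ω, Real.exp (-(s * (Θ ω + t * meanTower E δ r))) ∂E.P ≤ C ∧
        Integrable (fun ω ↦ Real.exp (s * Θ₂ ω)) E.P ∧
        ∫ ω, Real.exp (s * Θ₂ ω) ∂E.P ≤ C := fun E hE ↦
  uvExpMoments_of_chargeFree_bounds E hE (uvFarBite_expMoment_latticeEnsembles E hE)
    (uvFarBiteSq_expMoment_latticeEnsembles E hE) (uvCollar_expMoment_latticeEnsembles E hE)

end Summit.CriticalPhenomena.CardyFormulaZ2.Cruxes.NestingRigidity.PositiveConeWeightDoubling

end
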